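import Literature.Analysis.Fourier.TorusWeightedBandIBP
import HarnessLib

/-!
# A weighted DIVERGENCE-FORM integration-by-parts box inequality for Fourier coefficients on `T^d`
# `√(Σ_{|kⱼ| ≤ Lⱼ ∀ j} ‖𝓕a(k)‖²) ≤ ‖(1 − Σⱼ Wⱼ pⱼ) a‖₂ + (2π)⁻¹ ‖c · Σⱼ ∂ⱼWⱼ‖₂ + Σⱼ Lⱼ ‖Wⱼ c‖₂`   whenever `∂ⱼc = −2π pⱼ a`

Topic `Literature/Analysis/Fourier`; namespace `Literature.Analysis.Fourier`.  Analysis/Fourier support file (everything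
proved; no definitions, no named facts); the several-directions companion of `TorusWeightedBandIBP.lean`.  The
"non-stationary phase" principle [cite: Grafakos2014, Prop. 3.2.6 (8) (`𝓕(∂ⱼf)(m) = 2πi mⱼ 𝓕f(m)`)] with a smooth real
VECTOR weight `W = (Wⱼ)`: for smooth real `a, c` and families `pⱼ, Wⱼ` on `T^d` with `∂ⱼc = −2π pⱼ a` for every `j`
(model: `a = sin (2πφ)`, `c = cos (2πφ)`, `p = ∇φ`; the natural weight `W = ψ ∇φ/|∇φ|²` has NO singularity at the
folds `∂ᵢφ = 0` of a single direction, only where the full gradient is small),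

* `mFourierCoeff_ofReal_eq_weighted_div_ibp` — `𝓕a(k) = 𝓕((1 − Σⱼ Wⱼpⱼ) a)(k) + (2π)⁻¹ 𝓕(c Σⱼ ∂ⱼWⱼ)(k) − i Σⱼ kⱼ 𝓕(Wⱼ c)(k)`;
* `norm_mFourierCoeff_ofReal_le_weighted_div_ibp` — `‖𝓕a(k)‖ ≤ ‖𝓕((1 − Σ Wp)a)(k)‖ + (2π)⁻¹‖𝓕(c div W)(k)‖ + Σⱼ |kⱼ| ‖𝓕(Wⱼ c)(k)‖`;
* **`sqrt_tsum_box_sq_norm_mFourierCoeff_le_weighted_div_ibp`** — for a real symbol `0 ≤ χ ≤ 1` vanishing unless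
  `|kⱼ| ≤ Lⱼ` for all `j` (`0 ≤ Lⱼ`): `√(Σ' χ(k)‖𝓕a(k)‖²) ≤ √∫((1 − Σ Wp) a)² + (2π)⁻¹ √∫(c div W)² + Σⱼ Lⱼ √∫(Wⱼ c)²`
  (Bessel [cite: Grafakos2014, Prop. 3.2.7 (3) (Parseval)] and Minkowski).

Everything is proved; no definitions.
-/

noncomputable section

namespace Literature.Analysis.Fourier

open MeasureTheory Set Filter UnitAddTorus Complex
open _root_.Topology
open Literature.Analysis.FunctionSpaces Literature.Analysis.FunctionSpaces.Torus

variable {d : Type*} [Fintype d] [DecidableEq d]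

/-! ## §1 Plumbing: Fourier coefficients of finite sums; Minkowski for finite sums of families -/

omit [DecidableEq d] in
/-- Finite sums of smooth real functions on the torus are smooth. [folklore] -/
private theorem isSmooth_fun_finset_sum {ι : Type*} (s : Finset ι) {f : ι → UnitAddTorus d → ℝ}
    (h : ∀ i ∈ s, IsSmooth (f i)) : IsSmooth (fun x => ∑ i ∈ s, f i x) := by
  classical
  induction s using Finset.induction_on with
  | empty => simp only [Finset.sum_empty]; exact isSmooth_const (0 : ℝ)
  | @insert i s hi ih =>
      simp only [Finset.sum_insert hi]
      exact (h i (Finset.mem_insert_self i s)).add (ih fun j hj => h j (Finset.mem_insert_of_mem hj))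

omit [DecidableEq d] in
/-- Fourier coefficients of a finite sum of integrable functions. [folklore] -/
private theorem mFourierCoeff_finset_sum {ι : Type*} (s : Finset ι) {f : ι → UnitAddTorus d → ℂ}
    (hf : ∀ j ∈ s, Integrable (f j) volume) (k : d → ℤ) :
    mFourierCoeff (fun x => ∑ j ∈ s, f j x) k = ∑ j ∈ s, mFourierCoeff (f j) k := by
  classical
  induction s using Finset.induction_on with
  | empty =>
    simp only [Finset.sum_empty]
    rw [Torus.mFourierCoeff_eq_integral_volume]
    simp
  | @insert j s hj ih =>
    have hfj : Integrable (f j) volume := hf j (Finset.mem_insert_self j s)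
    have hfs : ∀ i ∈ s, Integrable (f i) volume := fun i hi => hf i (Finset.mem_insert_of_mem hi)
    have hsum : Integrable (fun x => ∑ i ∈ s, f i x) volume := integrable_finsetSum s hfs
    rw [Finset.sum_insert hj, ← ih hfs]
    have hadd := Torus.mFourierCoeff_add hfj hsum k
    have hfun : (fun x => ∑ i ∈ insert j s, f i x) = (f j) + fun x => ∑ i ∈ s, f i x := by
      funext x; simp [Finset.sum_insert hj]
    rw [hfun, hadd]

/-- Minkowski in `ℓ²(ι)` for two square-summable nonnegative families, `√`-form. [folklore] -/
private theorem sqrt_tsum_add_sq_le_add' {ι : Type*} {u v : ι → ℝ} (hu0 : ∀ k, 0 ≤ u k) (hv0 : ∀ k, 0 ≤ v k)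
    (hu : Summable fun k => u k ^ 2) (hv : Summable fun k => v k ^ 2) :
    (Summable fun k => (u k + v k) ^ 2) ∧
      Real.sqrt (∑' k, (u k + v k) ^ 2) ≤ Real.sqrt (∑' k, u k ^ 2) + Real.sqrt (∑' k, v k ^ 2) := by
  have hu' : Summable fun k => u k ^ (2 : ℝ) := by simpa [Real.rpow_two] using hu
  have hv' : Summable fun k => v k ^ (2 : ℝ) := by simpa [Real.rpow_two] using hv
  have h := Real.Lp_add_le_tsum_of_nonneg (p := 2) (by norm_num) hu0 hv0 hu' hv'
  simp only [Real.rpow_two] at h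
  refine ⟨h.1, ?_⟩
  simpa [Real.sqrt_eq_rpow] using h.2

/-- Minkowski in `ℓ²(ι)` for a finite sum of square-summable nonnegative families. [folklore] -/
private theorem sqrt_tsum_finset_sum_sq_le {ι κ : Type*} (s : Finset κ) {u : κ → ι → ℝ}
    (hu0 : ∀ j k, 0 ≤ u j k) (hu : ∀ j, Summable fun k => u j k ^ 2) :
    (Summable fun k => (∑ j ∈ s, u j k) ^ 2) ∧
      Real.sqrt (∑' k, (∑ j ∈ s, u j k) ^ 2) ≤ ∑ j ∈ s, Real.sqrt (∑' k, u j k ^ 2) := by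
  classical
  induction s using Finset.induction_on with
  | empty => simp [summable_zero]
  | @insert j s hj ih =>
    obtain ⟨hs, hle⟩ := ih
    have h2 := sqrt_tsum_add_sq_le_add' (hu0 j) (fun k => Finset.sum_nonneg fun i _ => hu0 i k) (hu j) hs
    simp only [Finset.sum_insert hj]
    exact ⟨h2.1, h2.2.trans (by linarith)⟩

/-! ## §2 The weighted divergence-form decomposition of `𝓕a(k)` and the pointwise bound -/

/-- **Weighted divergence-form decomposition**: if `∂ⱼc = −2π pⱼ a` for all `j` then for every smooth real vector weight
`W`, `𝓕a(k) = 𝓕((1 − Σⱼ Wⱼ pⱼ) a)(k) + (2π)⁻¹ 𝓕(c Σⱼ ∂ⱼWⱼ)(k) − i Σⱼ kⱼ 𝓕(Wⱼ c)(k)`. [cite: Grafakos2014, Prop. 3.2.6 (8)] -/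
theorem mFourierCoeff_ofReal_eq_weighted_div_ibp {a c : UnitAddTorus d → ℝ} {p W : d → UnitAddTorus d → ℝ}
    (ha : IsSmooth a) (hc : IsSmooth c) (hp : ∀ j, IsSmooth (p j)) (hW : ∀ j, IsSmooth (W j))
    (hrel : ∀ j x, partialDeriv j c x = -(2 * Real.pi) * (p j x * a x)) (k : d → ℤ) :
    mFourierCoeff (fun x => (a x : ℂ)) k =
      mFourierCoeff (fun x => (((1 - ∑ j, W j x * p j x) * a x : ℝ) : ℂ)) k +
        (1 / (2 * Real.pi) : ℂ) * mFourierCoeff (fun x => ((c x * ∑ j, partialDeriv j (W j) x : ℝ) : ℂ)) k -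
          Complex.I * ∑ j, (k j : ℂ) * mFourierCoeff (fun x => ((W j x * c x : ℝ) : ℂ)) k := by
  have hπ : (2 * Real.pi : ℂ) ≠ 0 := by
    exact_mod_cast (ne_of_gt (by positivity : (0 : ℝ) < 2 * Real.pi))
  -- pointwise: `a = (1 − Σ W p) a − (2π)⁻¹ Σⱼ Wⱼ ∂ⱼc`
  have hsplit : (fun x => (a x : ℂ)) =
      (fun x => (((1 - ∑ j, W j x * p j x) * a x : ℝ) : ℂ)) +
        fun x => ∑ j, (-(1 / (2 * Real.pi) : ℂ)) * ((W j x * partialDeriv j c x : ℝ) : ℂ) := by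
    funext x
    simp only [Pi.add_apply]
    have : ∀ j, ((W j x * partialDeriv j c x : ℝ) : ℂ) = -(2 * Real.pi) * ((W j x * p j x * a x : ℝ) : ℂ) := by
      intro j; rw [hrel j x]; push_cast; ring
    simp_rw [this]
    push_cast
    rw [← Finset.mul_sum, ← Finset.mul_sum, ← Finset.sum_mul]
    field_simp
    ring
  have hint1 : Integrable (fun x => (((1 - ∑ j, W j x * p j x) * a x : ℝ) : ℂ)) volume := by
    have hs : IsSmooth (fun x => ∑ j, W j x * p j x) :=
      isSmooth_fun_finset_sum Finset.univ fun j _ => (hW j).smul' (hp j)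
    exact ((((isSmooth_const (1 : ℝ)).sub hs).smul' ha).ofReal_comp).integrable
  have hintj : ∀ j ∈ (Finset.univ : Finset d),
      Integrable (fun x => (-(1 / (2 * Real.pi) : ℂ)) * ((W j x * partialDeriv j c x : ℝ) : ℂ)) volume :=
    fun j _ => ((((hW j).smul' (hc.partialDeriv j)).ofReal_comp).integrable).const_mul _
  have hint2 : Integrable (fun x => ∑ j, (-(1 / (2 * Real.pi) : ℂ)) * ((W j x * partialDeriv j c x : ℝ) : ℂ)) volume :=
    integrable_finsetSum _ hintj
  have hadd := Torus.mFourierCoeff_add hint1 hint2 k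
  have hsum := mFourierCoeff_finset_sum Finset.univ hintj k
  have hcm : ∀ j, mFourierCoeff (fun x => (-(1 / (2 * Real.pi) : ℂ)) * ((W j x * partialDeriv j c x : ℝ) : ℂ)) k =
      (-(1 / (2 * Real.pi) : ℂ)) * mFourierCoeff (fun x => ((W j x * partialDeriv j c x : ℝ) : ℂ)) k := by
    intro j
    simp only [Torus.mFourierCoeff_eq_integral_volume, smul_eq_mul, ← integral_const_mul]
    congr 1 with x
    ring
  -- `𝓕(c Σⱼ ∂ⱼWⱼ) = Σⱼ 𝓕(c ∂ⱼWⱼ)`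
  have hdiv : mFourierCoeff (fun x => ((c x * ∑ j, partialDeriv j (W j) x : ℝ) : ℂ)) k =
      ∑ j, mFourierCoeff (fun x => ((c x * partialDeriv j (W j) x : ℝ) : ℂ)) k := by
    have hI : ∀ j ∈ (Finset.univ : Finset d), Integrable (fun x => ((c x * partialDeriv j (W j) x : ℝ) : ℂ)) volume :=
      fun j _ => ((hc.smul' ((hW j).partialDeriv j)).ofReal_comp).integrable
    rw [← mFourierCoeff_finset_sum Finset.univ hI k]
    congr 1; funext x; push_cast; rw [Finset.mul_sum]
  rw [hsplit, hadd, hsum, hdiv, Finset.mul_sum, Finset.mul_sum, add_sub_assoc, ← Finset.sum_sub_distrib]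
  congr 1
  refine Finset.sum_congr rfl fun j _ => ?_
  rw [hcm, mFourierCoeff_ofReal_mul_partialDeriv (hW j) hc]
  field_simp
  ring

/-- **Pointwise bound**: `‖𝓕a(k)‖ ≤ ‖𝓕((1 − Σ W p)a)(k)‖ + (2π)⁻¹ ‖𝓕(c div W)(k)‖ + Σⱼ |kⱼ| ‖𝓕(Wⱼ c)(k)‖`.
[cite: Grafakos2014, Prop. 3.2.6 (8)] -/
theorem norm_mFourierCoeff_ofReal_le_weighted_div_ibp {a c : UnitAddTorus d → ℝ} {p W : d → UnitAddTorus d → ℝ}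
    (ha : IsSmooth a) (hc : IsSmooth c) (hp : ∀ j, IsSmooth (p j)) (hW : ∀ j, IsSmooth (W j))
    (hrel : ∀ j x, partialDeriv j c x = -(2 * Real.pi) * (p j x * a x)) (k : d → ℤ) :
    ‖mFourierCoeff (fun x => (a x : ℂ)) k‖ ≤
      ‖mFourierCoeff (fun x => (((1 - ∑ j, W j x * p j x) * a x : ℝ) : ℂ)) k‖ +
        1 / (2 * Real.pi) * ‖mFourierCoeff (fun x => ((c x * ∑ j, partialDeriv j (W j) x : ℝ) : ℂ)) k‖ +
          ∑ j, |(k j : ℝ)| * ‖mFourierCoeff (fun x => ((W j x * c x : ℝ) : ℂ)) k‖ := by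
  rw [mFourierCoeff_ofReal_eq_weighted_div_ibp ha hc hp hW hrel k]
  have hπ0 : 0 < 2 * Real.pi := by positivity
  refine (norm_sub_le _ _).trans ?_
  refine add_le_add ((norm_add_le _ _).trans (add_le_add le_rfl ?_)) ?_
  · rw [norm_mul]
    gcongr
    rw [show (1 / (2 * Real.pi) : ℂ) = ((1 / (2 * Real.pi) : ℝ) : ℂ) by push_cast; ring, Complex.norm_real,
      Real.norm_of_nonneg (by positivity)]
  · rw [norm_mul, Complex.norm_I, one_mul]
    refine (norm_sum_le _ _).trans (Finset.sum_le_sum fun j _ => ?_)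
    rw [norm_mul, Complex.norm_intCast]

/-! ## §3 The box inequality (Bessel ≤ Parseval termwise, Minkowski) -/

/-- **The weighted divergence-form box inequality, sharp (Minkowski) form.**  Let `a, c` be smooth real functions and
`pⱼ, Wⱼ` smooth real families on `T^d` with `∂ⱼc = −2π pⱼ a` for all `j`; let `χ` be a real symbol with `0 ≤ χ ≤ 1` and
`χ(k) = 0` unless `|kⱼ| ≤ Lⱼ` for every `j` (`0 ≤ Lⱼ`).  Then
`√(Σ' χ(k) ‖𝓕a(k)‖²) ≤ √∫((1 − Σ W p) a)² + (2π)⁻¹ √∫(c Σⱼ∂ⱼWⱼ)² + Σⱼ Lⱼ √∫(Wⱼ c)²`.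
[cite: Grafakos2014, Prop. 3.2.6 (8) and Prop. 3.2.7 (3)] -/
theorem sqrt_tsum_box_sq_norm_mFourierCoeff_le_weighted_div_ibp {a c : UnitAddTorus d → ℝ}
    {p W : d → UnitAddTorus d → ℝ} (ha : IsSmooth a) (hc : IsSmooth c) (hp : ∀ j, IsSmooth (p j))
    (hW : ∀ j, IsSmooth (W j)) (hrel : ∀ j x, partialDeriv j c x = -(2 * Real.pi) * (p j x * a x))
    {L : d → ℝ} (hL : ∀ j, 0 ≤ L j) {χ : (d → ℤ) → ℝ} (hχ0 : ∀ k, 0 ≤ χ k) (hχ1 : ∀ k, χ k ≤ 1)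
    (hχL : ∀ k, (∃ j, L j < |(k j : ℝ)|) → χ k = 0) :
    Real.sqrt (∑' k, χ k * ‖mFourierCoeff (fun x => (a x : ℂ)) k‖ ^ 2) ≤
      Real.sqrt (∫ x, ((1 - ∑ j, W j x * p j x) * a x) ^ 2) +
        1 / (2 * Real.pi) * Real.sqrt (∫ x, (c x * ∑ j, partialDeriv j (W j) x) ^ 2) +
          ∑ j, L j * Real.sqrt (∫ x, (W j x * c x) ^ 2) := by
  set f₁ : UnitAddTorus d → ℝ := fun x => (1 - ∑ j, W j x * p j x) * a x with hf₁
  set f₂ : UnitAddTorus d → ℝ := fun x => c x * ∑ j, partialDeriv j (W j) x with hf₂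
  set f₃ : d → UnitAddTorus d → ℝ := fun j x => W j x * c x with hf₃
  have hs : IsSmooth (fun x => ∑ j, W j x * p j x) :=
    isSmooth_fun_finset_sum Finset.univ fun j _ => (hW j).smul' (hp j)
  have hs' : IsSmooth (fun x => ∑ j, partialDeriv j (W j) x) :=
    isSmooth_fun_finset_sum Finset.univ fun j _ => (hW j).partialDeriv j
  have hf₁c : Continuous f₁ := (((isSmooth_const (1 : ℝ)).sub hs).smul' ha).continuous
  have hf₂c : Continuous f₂ := (hc.smul' hs').continuous
  have hf₃c : ∀ j, Continuous (f₃ j) := fun j => ((hW j).smul' hc).continuous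
  have hπ0 : 0 < 2 * Real.pi := by positivity
  have hπ' : 0 ≤ 1 / (2 * Real.pi) := by positivity
  set r : (d → ℤ) → ℝ := fun k => Real.sqrt (χ k) with hr
  have hr0 : ∀ k, 0 ≤ r k := fun k => Real.sqrt_nonneg _
  have hr2 : ∀ k, r k ^ 2 = χ k := fun k => Real.sq_sqrt (hχ0 k)
  set u : (d → ℤ) → ℝ := fun k => r k * ‖mFourierCoeff (fun x => (a x : ℂ)) k‖ with hu
  set U₁ : (d → ℤ) → ℝ := fun k => r k * ‖mFourierCoeff (fun x => (f₁ x : ℂ)) k‖ with hU₁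
  set U₂ : (d → ℤ) → ℝ := fun k => r k * (1 / (2 * Real.pi) * ‖mFourierCoeff (fun x => (f₂ x : ℂ)) k‖) with hU₂
  set U₃ : d → (d → ℤ) → ℝ := fun j k => r k * (L j * ‖mFourierCoeff (fun x => (f₃ j x : ℂ)) k‖) with hU₃
  have hu0 : ∀ k, 0 ≤ u k := fun k => mul_nonneg (hr0 k) (norm_nonneg _)
  have hU₁0 : ∀ k, 0 ≤ U₁ k := fun k => mul_nonneg (hr0 k) (norm_nonneg _)
  have hU₂0 : ∀ k, 0 ≤ U₂ k := fun k => mul_nonneg (hr0 k) (mul_nonneg hπ' (norm_nonneg _))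
  have hU₃0 : ∀ j k, 0 ≤ U₃ j k := fun j k => mul_nonneg (hr0 k) (mul_nonneg (hL j) (norm_nonneg _))
  -- pointwise domination `u ≤ U₁ + (U₂ + Σⱼ U₃ j)`
  have hdom : ∀ k, u k ≤ U₁ k + (U₂ k + ∑ j, U₃ j k) := by
    intro k
    by_cases hk : ∃ j, L j < |(k j : ℝ)|
    · have h0 : r k = 0 := by rw [hr]; simp [hχL k hk]
      simp [hu, hU₁, hU₂, hU₃, h0]
    · push Not at hk
      have hpt := norm_mFourierCoeff_ofReal_le_weighted_div_ibp ha hc hp hW hrel k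
      have hki : ∑ j, |(k j : ℝ)| * ‖mFourierCoeff (fun x => ((W j x * c x : ℝ) : ℂ)) k‖ ≤
          ∑ j, L j * ‖mFourierCoeff (fun x => (f₃ j x : ℂ)) k‖ :=
        Finset.sum_le_sum fun j _ => mul_le_mul_of_nonneg_right (hk j) (norm_nonneg _)
      have h3 : ‖mFourierCoeff (fun x => (a x : ℂ)) k‖ ≤
          ‖mFourierCoeff (fun x => (f₁ x : ℂ)) k‖ + (1 / (2 * Real.pi) * ‖mFourierCoeff (fun x => (f₂ x : ℂ)) k‖ +
            ∑ j, L j * ‖mFourierCoeff (fun x => (f₃ j x : ℂ)) k‖) := by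
        refine hpt.trans ?_
        simp only [hf₁, hf₂]
        linarith
      have := mul_le_mul_of_nonneg_left h3 (hr0 k)
      simp only [hu, hU₁, hU₂, hU₃]
      rw [← Finset.mul_sum]
      linarith [this]
  -- square-summability of the majorants (Bessel)
  have hsq : ∀ (f : UnitAddTorus d → ℝ), Continuous f → ∀ (t : ℝ), 0 ≤ t →
      (Summable fun k => (r k * (t * ‖mFourierCoeff (fun x => (f x : ℂ)) k‖)) ^ 2) ∧
        Real.sqrt (∑' k, (r k * (t * ‖mFourierCoeff (fun x => (f x : ℂ)) k‖)) ^ 2) ≤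
          t * Real.sqrt (∫ x, f x ^ 2) := by
    intro f hf t ht
    have heq : ∀ k, (r k * (t * ‖mFourierCoeff (fun x => (f x : ℂ)) k‖)) ^ 2 =
        t ^ 2 * (χ k * ‖mFourierCoeff (fun x => (f x : ℂ)) k‖ ^ 2) := fun k => by
      rw [mul_pow, mul_pow, hr2 k]; ring
    have hP := Torus.hasSum_sq_mFourierCoeff_ofReal hf
    have hs0 : Summable fun k => χ k * ‖mFourierCoeff (fun x => (f x : ℂ)) k‖ ^ 2 :=
      Summable.of_nonneg_of_le (fun k => mul_nonneg (hχ0 k) (sq_nonneg _))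
        (fun k => by nlinarith [hχ1 k, hχ0 k, sq_nonneg ‖mFourierCoeff (fun x => (f x : ℂ)) k‖]) hP.summable
    refine ⟨(hs0.mul_left (t ^ 2)).congr fun k => (heq k).symm, ?_⟩
    rw [tsum_congr heq, tsum_mul_left, Real.sqrt_mul' _ (tsum_nonneg fun k => mul_nonneg (hχ0 k) (sq_nonneg _)),
      Real.sqrt_sq ht]
    exact mul_le_mul_of_nonneg_left
      (Real.sqrt_le_sqrt (tsum_symbol_mul_sq_norm_mFourierCoeff_le_integral_sq hf hχ0 hχ1)) ht
  obtain ⟨hS₁, hB₁⟩ := hsq f₁ hf₁c 1 zero_le_one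
  obtain ⟨hS₂, hB₂⟩ := hsq f₂ hf₂c (1 / (2 * Real.pi)) hπ'
  have hS₃ : ∀ j, Summable fun k => U₃ j k ^ 2 := fun j => (hsq (f₃ j) (hf₃c j) (L j) (hL j)).1
  have hB₃ : ∀ j, Real.sqrt (∑' k, U₃ j k ^ 2) ≤ L j * Real.sqrt (∫ x, f₃ j x ^ 2) :=
    fun j => (hsq (f₃ j) (hf₃c j) (L j) (hL j)).2
  simp only [one_mul] at hS₁ hB₁
  -- Minkowski: finite sum over `j`, then the three groups
  obtain ⟨hS₃s, hM₃⟩ := sqrt_tsum_finset_sum_sq_le Finset.univ hU₃0 hS₃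
  obtain ⟨hS₂₃, hM₂₃⟩ := sqrt_tsum_add_sq_le_add' hU₂0 (fun k => Finset.sum_nonneg fun j _ => hU₃0 j k) hS₂ hS₃s
  obtain ⟨hS, hM⟩ := sqrt_tsum_add_sq_le_add' hU₁0
    (fun k => add_nonneg (hU₂0 k) (Finset.sum_nonneg fun j _ => hU₃0 j k)) hS₁ hS₂₃
  have hu2 : ∀ k, χ k * ‖mFourierCoeff (fun x => (a x : ℂ)) k‖ ^ 2 = u k ^ 2 := fun k => by
    rw [hu]; simp only; rw [mul_pow, hr2 k]
  have hule : ∀ k, u k ^ 2 ≤ (U₁ k + (U₂ k + ∑ j, U₃ j k)) ^ 2 := fun k => pow_le_pow_left₀ (hu0 k) (hdom k) 2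
  have hsu : Summable fun k => u k ^ 2 := Summable.of_nonneg_of_le (fun k => sq_nonneg _) hule hS
  calc Real.sqrt (∑' k, χ k * ‖mFourierCoeff (fun x => (a x : ℂ)) k‖ ^ 2)
      = Real.sqrt (∑' k, u k ^ 2) := by rw [tsum_congr hu2]
    _ ≤ Real.sqrt (∑' k, (U₁ k + (U₂ k + ∑ j, U₃ j k)) ^ 2) := Real.sqrt_le_sqrt (hsu.tsum_le_tsum hule hS)
    _ ≤ Real.sqrt (∑' k, U₁ k ^ 2) + Real.sqrt (∑' k, (U₂ k + ∑ j, U₃ j k) ^ 2) := hM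
    _ ≤ Real.sqrt (∑' k, U₁ k ^ 2) + (Real.sqrt (∑' k, U₂ k ^ 2) + Real.sqrt (∑' k, (∑ j, U₃ j k) ^ 2)) := by
        gcongr
    _ ≤ Real.sqrt (∑' k, U₁ k ^ 2) + (Real.sqrt (∑' k, U₂ k ^ 2) + ∑ j, Real.sqrt (∑' k, U₃ j k ^ 2)) := by
        gcongr
    _ ≤ Real.sqrt (∫ x, f₁ x ^ 2) + (1 / (2 * Real.pi) * Real.sqrt (∫ x, f₂ x ^ 2) +
          ∑ j, L j * Real.sqrt (∫ x, f₃ j x ^ 2)) :=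
        add_le_add hB₁ (add_le_add hB₂ (Finset.sum_le_sum fun j _ => hB₃ j))
    _ = _ := by ring

end Literature.Analysis.Fourier

end
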